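import Literature.AlgebraicGeometry.Motives.MixedHodgeStructureCatTateObjects
import Literature.AlgebraicGeometry.Motives.MixedHodgeStructureCatRigid
import HarnessLib

/-!
# Products of Hodge classes are Hodge classes: `Hdgᵖ(X) ⊗ Hdg^q(Y) → Hdg^{p+q}(X ⊗ Y)` in `MixedHodgeStructureCat`, categorically

Layer `Literature/AlgebraicGeometry/Motives` (lane `lit-hodgefound`), continuing `Motives/MixedHodgeStructureCatHodgeClasses` (`homTateLinearEquiv p X : (ℚ(−p) ⟶ X) ≃ Hdgᵖ(X)`,
`f ↦ f(1)`), g45-#13 (`tensorHom`), g45-#19 (`tateMulIso : ℚ(i) ⊗ ℚ(j) ≅ ℚ(i+j)`) and g45-#17 (`coevHom`, `coevTensor`).  A Hodge class of type `(p, p)` of `X` IS a morphism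
`ℚ(−p) → X`; hence the tensor product of two Hodge classes `v ∈ Hdgᵖ(X)`, `w ∈ Hdg^q(Y)` is the value at `1` of the MORPHISM
`ℚ(−(p+q)) = ℚ(−p) ⊗ ℚ(−q) → X ⊗ Y`, `f_v ⊗ f_w` — so **`v ⊗ w ∈ Hdg^{p+q}(X ⊗ Y)`** with no computation on filtrations (Deligne, *Hodge II* 2.1.14 / the Künneth
compatibility of Hodge classes; for varieties: the cup product of Hodge classes is Hodge).  Likewise the identity `𝟙_X`, i.e. the coevaluation `δ_X : ℚ(0) → X ⊗ X^∨`,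
gives the HODGE CLASS OF THE DIAGONAL `Σᵢ eᵢ ⊗ eᵢ^* ∈ Hdg⁰(X ⊗ X^∨)`.

* §1 `(ℚ(i) ⊗ ℚ(j) ≅ ℚ(i+j))⁻¹(1) = 1 ⊗ 1`; the morphism **`hodgeClassTensorHom p q v w : ℚ(−(p+q)) ⟶ X ⊗ Y`** and its value `v ⊗ w` at `1`;
* §2 **`tmul_mem_hodgeClasses_tensorObj`**: `v ∈ Hdgᵖ(X), w ∈ Hdg^q(Y) ⟹ v ⊗ w ∈ Hdg^{p+q}(X ⊗ Y)`; the bilinear map **`hodgeClassesTensor p q`**;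
* §3 **`comm_coevTensor_mem_hodgeClasses`**: `Σᵢ eᵢ ⊗ eᵢ^* ∈ Hdg⁰(X ⊗ X^∨)` and `coevTensor_mem_hodgeClasses : Σᵢ eᵢ^* ⊗ eᵢ ∈ Hdg⁰(X^∨ ⊗ X)`; more generally the
  tensor `Σᵢ eᵢ^* ⊗ f(eᵢ)` of any morphism `f : X ⟶ X` is a Hodge class (`lTensor_coevTensor_mem_hodgeClasses`).

Everything is PROVED; no named fact, no instance, no notation.  Data: `hodgeClassTensorHom`, `hodgeClassesTensor`.

Sources, verbatim (through the tree's files).  P. Deligne, *Théorie de Hodge II* (1971) [DeligneHodgeII1971], 1.1.12, 2.1.13–2.1.14, 2.3.1 (morphisms `ℚ(−p) → H` and Hodge classes).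
D. Arapura, [Arapura2022] §1 p. 3 (`Hdgᵖ(H) = Hom_MHS(ℚ(−p), H)`).  P. Deligne, J. S. Milne, *Tannakian categories* (1982) [DeligneMilne1982Tannakian], §1 (1.6.4)–(1.7) (`δ`,
`Hom(1, X ⊗ Y)`).  E. Cattani et al. (eds.), *Hodge Theory* (2014) [CattaniElZeinGriffithsLe2014], Def. 3.1.9 ∕ §3.2.2.7 (Hodge classes; tensor products).

## Main results

* §1 `tateMulIso_inv_toLinearMap_up_one`, **`hodgeClassTensorHom`**, **`hodgeClassTensorHom_toLinearMap_up_one`**.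
* §2 **`tmul_mem_hodgeClasses_tensorObj`**, **`hodgeClassesTensor`**, `coe_hodgeClassesTensor_apply`.
* §3 **`comm_coevTensor_mem_hodgeClasses`**, **`lTensor_coevTensor_mem_hodgeClasses`**, **`coevTensor_mem_hodgeClasses`**.

## References

* [DeligneHodgeII1971] P. Deligne, Théorie de Hodge II, Publ. Math. IHÉS 40 (1971), 1.1.12, 2.1.13–2.1.14, 2.3.1.
* [Arapura2022] D. Arapura (as keyed in references.bib), §1 p. 3.
* [DeligneMilne1982Tannakian] P. Deligne, J. S. Milne, Tannakian categories, in LNM 900 (1982), §1 (1.6.4)–(1.7).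
* [CattaniElZeinGriffithsLe2014] E. Cattani et al. (eds.), Hodge Theory, Princeton Math. Notes 49 (2014), Def. 3.1.9, Ch. 3 §3.2.2.7.

## Provenance

Lane `lit-hodgefound` (summit `HodgeConjecture`), seat `lit-hodgefound-p36` (literature-prover, generation 45, row g45-#26).
-/

noncomputable section

open CategoryTheory CategoryTheory.Limits
open scoped TensorProduct

namespace Literature.AlgebraicGeometry.Motives

universe u

namespace MixedHodgeStructureCat

variable {X Y : MixedHodgeStructureCat.{u}} [Module.Finite ℚ X] [Module.Finite ℚ Y]

/-! ## §1 The morphism `ℚ(−(p+q)) → X ⊗ Y` of two Hodge classes -/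

/-- `(ℚ(i) ⊗ ℚ(j) ≅ ℚ(i+j))⁻¹(1) = 1 ⊗ 1`. [cite: DeligneHodgeII1971, 2.1.13] -/
theorem tateMulIso_inv_toLinearMap_up_one (i j : ℤ) :
    haveI := finite_tateObj.{u} i; haveI := finite_tateObj.{u} j;
    (tateMulIso.{u} i j).inv.toLinearMap (ULift.up 1) =
      @TensorProduct.tmul ℚ _ (tateObj.{u} i) (tateObj.{u} j) _ _ _ _ (ULift.up.{u} (1 : ℚ)) (ULift.up.{u} (1 : ℚ)) := by
  haveI := finite_tateObj.{u} i
  haveI := finite_tateObj.{u} j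
  have h : (tateMulIso.{u} i j).hom.toLinearMap (@TensorProduct.tmul ℚ _ (tateObj.{u} i) (tateObj.{u} j) _ _ _ _ (ULift.up.{u} (1 : ℚ)) (ULift.up.{u} (1 : ℚ))) =
      ULift.up 1 := by
    rw [tateMulIso_hom_toLinearMap_apply_tmul]
    exact congrArg ULift.up (mul_one _)
  conv_lhs => rw [← h]
  rw [← LinearMap.comp_apply, ← comp_toLinearMap, Iso.hom_inv_id]
  rfl

/-- **The morphism `ℚ(−(p+q)) = ℚ(−p) ⊗ ℚ(−q) ⟶ X ⊗ Y`, `f_v ⊗ f_w`, of two Hodge classes** `v ∈ Hdgᵖ(X)`, `w ∈ Hdg^q(Y)` (`f_v : ℚ(−p) → X` the morphism `q ↦ q v`).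
[cite: DeligneHodgeII1971, 2.3.1 and 1.1.12] [cite: Arapura2022, §1 (p. 3)] -/
def hodgeClassTensorHom (p q : ℤ) (v : X.str.hodgeClasses p) (w : Y.str.hodgeClasses q) : tateObj.{u} (-(p + q)) ⟶ tensorObj X Y :=
  haveI := finite_tateObj.{u} (-p)
  haveI := finite_tateObj.{u} (-q)
  eqToHom (congrArg tateObj.{u} (neg_add p q)) ≫ (tateMulIso.{u} (-p) (-q)).inv ≫ tensorHom ((homTateLinearEquiv p X).symm v) ((homTateLinearEquiv q Y).symm w)

/-- **`(f_v ⊗ f_w)(1) = v ⊗ w`.** [cite: DeligneHodgeII1971, 2.3.1 and 1.1.12] -/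
theorem hodgeClassTensorHom_toLinearMap_up_one (p q : ℤ) (v : X.str.hodgeClasses p) (w : Y.str.hodgeClasses q) :
    (hodgeClassTensorHom p q v w).toLinearMap (ULift.up 1) = (v : X) ⊗ₜ[ℚ] (w : Y) := by
  haveI := finite_tateObj.{u} (-p)
  haveI := finite_tateObj.{u} (-q)
  change (tensorHom ((homTateLinearEquiv p X).symm v) ((homTateLinearEquiv q Y).symm w)).toLinearMap
      ((tateMulIso.{u} (-p) (-q)).inv.toLinearMap (MixedHodgeStructure.Hom.toLinearMap (eqToHom (congrArg tateObj.{u} (neg_add p q))) (ULift.up 1))) = _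
  have h1 : MixedHodgeStructure.Hom.toLinearMap (eqToHom (congrArg tateObj.{u} (neg_add p q))) (ULift.up 1) = ULift.up 1 := by
    rw [eqToHom_toLinearMap_apply]
    rfl
  have h2 := tateMulIso_inv_toLinearMap_up_one.{u} (-p) (-q)
  have h3 := tensorHom_toLinearMap_apply_tmul ((homTateLinearEquiv p X).symm v) ((homTateLinearEquiv q Y).symm w) (ULift.up.{u} (1 : ℚ)) (ULift.up.{u} (1 : ℚ))
  have h4 : MixedHodgeStructure.Hom.toLinearMap ((homTateLinearEquiv p X).symm v) (ULift.up.{u} (1 : ℚ)) = (v : X) := by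
    rw [homTateLinearEquiv_symm_apply_toLinearMap_apply, one_smul]
  have h5 : MixedHodgeStructure.Hom.toLinearMap ((homTateLinearEquiv q Y).symm w) (ULift.up.{u} (1 : ℚ)) = (w : Y) := by
    rw [homTateLinearEquiv_symm_apply_toLinearMap_apply, one_smul]
  rw [h1, h2, h3, h4, h5]

/-! ## §2 Products of Hodge classes are Hodge classes -/

/-- **`v ∈ Hdgᵖ(X), w ∈ Hdg^q(Y) ⟹ v ⊗ w ∈ Hdg^{p+q}(X ⊗ Y)`** — the value at `1` of the morphism `ℚ(−(p+q)) → X ⊗ Y` (the cup product of Hodge classes is a Hodge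
class). [cite: DeligneHodgeII1971, 2.1.14 and 1.1.12] [cite: CattaniElZeinGriffithsLe2014, Ch. 3 §3.2.2.7] -/
theorem tmul_mem_hodgeClasses_tensorObj {p q : ℤ} {v : X} {w : Y} (hv : v ∈ X.str.hodgeClasses p) (hw : w ∈ Y.str.hodgeClasses q) :
    v ⊗ₜ[ℚ] w ∈ (tensorObj X Y).str.hodgeClasses (p + q) := by
  have h := (homTateLinearEquiv (p + q) (tensorObj X Y) (hodgeClassTensorHom p q ⟨v, hv⟩ ⟨w, hw⟩)).2
  rwa [coe_homTateLinearEquiv_apply, hodgeClassTensorHom_toLinearMap_up_one] at h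

/-- **The bilinear map `Hdgᵖ(X) × Hdg^q(Y) → Hdg^{p+q}(X ⊗ Y)`, `(v, w) ↦ v ⊗ w`.** [cite: DeligneHodgeII1971, 2.1.14 and 1.1.12] -/
def hodgeClassesTensor (p q : ℤ) : X.str.hodgeClasses p →ₗ[ℚ] Y.str.hodgeClasses q →ₗ[ℚ] (tensorObj X Y).str.hodgeClasses (p + q) :=
  LinearMap.mk₂ ℚ (fun v w => ⟨(v : X) ⊗ₜ[ℚ] (w : Y), tmul_mem_hodgeClasses_tensorObj v.2 w.2⟩)
    (fun _ _ _ => Subtype.ext (TensorProduct.add_tmul _ _ _))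
    (fun c _ _ => Subtype.ext (TensorProduct.smul_tmul' c _ _).symm)
    (fun _ _ _ => Subtype.ext (TensorProduct.tmul_add _ _ _))
    (fun c _ _ => Subtype.ext (TensorProduct.tmul_smul c _ _))

/-- `hodgeClassesTensor p q v w = v ⊗ w`. [cite: DeligneHodgeII1971, 2.1.14] -/
theorem coe_hodgeClassesTensor_apply (p q : ℤ) (v : X.str.hodgeClasses p) (w : Y.str.hodgeClasses q) :
    (hodgeClassesTensor p q v w : ↥(tensorObj X Y)) = (v : X) ⊗ₜ[ℚ] (w : Y) := rfl

/-! ## §3 The Hodge class of the identity (the diagonal) -/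

variable (X) in
/-- **`Σᵢ eᵢ ⊗ eᵢ^* ∈ Hdg⁰(X ⊗ X^∨)`**: the value at `1` of the coevaluation `δ_X : ℚ(0) → X ⊗ X^∨` (the Hodge class of the identity ∕ of the diagonal).
[cite: DeligneMilne1982Tannakian, §1 (1.6.4)–(1.7)] [cite: DeligneHodgeII1971, 2.3.1] -/
theorem comm_coevTensor_mem_hodgeClasses : TensorProduct.comm ℚ (Module.Dual ℚ X) X (coevTensor X) ∈ (tensorObj X (of X.str.dual)).str.hodgeClasses 0 := by
  have h : (coevHom X).toLinearMap (ULift.up 1) ∈ (tensorObj X (of X.str.dual)).str.hodgeClasses 0 :=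
    apply_one_mem_hodgeClasses 0 (coevHom X : tateObj.{u} (-0) ⟶ tensorObj X (of X.str.dual))
  rwa [coevHom_toLinearMap_apply, one_smul] at h

variable (X) in
/-- **`Σᵢ eᵢ^* ⊗ f(eᵢ) ∈ Hdg⁰(X^∨ ⊗ X)` for every morphism `f : X ⟶ X`** (the image of `f ∈ Hdg⁰(Hom(X, X))` under `Hom(X, X) ≅ X^∨ ⊗ X`; `f = 𝟙` gives the class of
the identity). [cite: DeligneHodgeII1971, 1.1.12 and 2.3.1] [cite: DeligneMilne1982Tannakian, §1 (1.6.4)] -/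
theorem lTensor_coevTensor_mem_hodgeClasses (f : X ⟶ X) :
    LinearMap.lTensor (Module.Dual ℚ X) f.toLinearMap (coevTensor X) ∈ (tensorObj (of X.str.dual) X).str.hodgeClasses 0 := by
  -- the morphism `ℚ(0) → Hom(X, X) ≅ X^∨ ⊗ X` attached to `f`
  have h : (homLinearEquivTateHom X X f ≫ (ihomIsoDualTensor X X).hom).toLinearMap (ULift.up 1) ∈ (tensorObj (of X.str.dual) X).str.hodgeClasses 0 :=
    apply_one_mem_hodgeClasses 0 ((homLinearEquivTateHom X X f ≫ (ihomIsoDualTensor X X).hom : tateObj.{u} (-0) ⟶ tensorObj (of X.str.dual) X))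
  have hval : (homLinearEquivTateHom X X f ≫ (ihomIsoDualTensor X X).hom).toLinearMap (ULift.up 1) = LinearMap.lTensor (Module.Dual ℚ X) f.toLinearMap (coevTensor X) := by
    have h1 : (homLinearEquivTateHom X X f).toLinearMap (ULift.up 1) = (f.toLinearMap : X →ₗ[ℚ] X) := by
      change (1 : ℚ) • (f.toLinearMap : X →ₗ[ℚ] X) = _
      rw [one_smul]
    rw [comp_toLinearMap, LinearMap.comp_apply, h1]
    change (MixedHodgeStructure.homToTensor X.str X.str).toLinearMap (f.toLinearMap ∘ₗ LinearMap.id) = _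
    rw [← dualTensorHom_coevTensor, ← dualTensorHom_lTensor', MixedHodgeStructure.homToTensor_toLinearMap, LinearEquiv.coe_coe, dualTensorHomEquiv,
      dualTensorHomEquivOfBasis_symm_cancel_left]
  rwa [hval] at h
where
  /-- `dualTensorHom ((1 ⊗ f) t) = f ∘ dualTensorHom t` (as in g45-#25). -/
  dualTensorHom_lTensor' (f : X →ₗ[ℚ] X) (t : Module.Dual ℚ X ⊗[ℚ] X) :
      dualTensorHom ℚ X X (LinearMap.lTensor (Module.Dual ℚ X) f t) = f ∘ₗ dualTensorHom ℚ X X t := by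
    induction t using TensorProduct.induction_on with
    | zero => simp only [map_zero, LinearMap.comp_zero]
    | tmul φ x =>
      rw [LinearMap.lTensor_tmul]
      refine LinearMap.ext fun v => ?_
      rw [dualTensorHom_apply, LinearMap.comp_apply, dualTensorHom_apply, map_smul]
    | add t₁ t₂ h₁ h₂ => simp only [map_add, h₁, h₂, LinearMap.comp_add]

variable (X) in
/-- **`Σᵢ eᵢ^* ⊗ eᵢ ∈ Hdg⁰(X^∨ ⊗ X)`** (the case `f = 𝟙`). [cite: DeligneMilne1982Tannakian, §1 (1.6.4)–(1.7)] -/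
theorem coevTensor_mem_hodgeClasses : coevTensor X ∈ (tensorObj (of X.str.dual) X).str.hodgeClasses 0 := by
  have h := lTensor_coevTensor_mem_hodgeClasses X (𝟙 X)
  rwa [show MixedHodgeStructure.Hom.toLinearMap (𝟙 X) = LinearMap.id from rfl, LinearMap.lTensor_id, LinearMap.id_apply] at h

end MixedHodgeStructureCat

end Literature.AlgebraicGeometry.Motives
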